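/-
Origin: expansion seat `planner-pub-hodgecm-pv03-g2-0`, handover 2026-08-18T05:37:07Z (`HOME/pub-hodgecm-pv03-g2/lean/Pv03g2/PerL34/StepsVacuity.lean`, md5 e37bee85, 407 lines);
landed by the gen-6 packager in gate run 23 as `HodgeCM/PerL34/StepsVacuity.lean` (stripped 3 #print/#check/#eval lines).
-/
/-
Copyright: pub-hodgecm formalisation cell (harness21, 2026). New file (not vendored).
Origin: HOME/pub-hodgecm-pv03-g2/lean/Pv03g2/PerL34/StepsVacuity.lean (WIP module `Pv03g2.PerL34.StepsVacuity`;
intended final place `HodgeCM/PerL34/StepsVacuity.lean` = module `HodgeCM.PerL34.StepsVacuity`)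
(seat planner-pub-hodgecm-pv03-g2-0, DAG node N33, PerL v5 Prop 4.3 `prop:S12`, tex ll. 639–682; referee A round 15 item P1,
seams S1/S2 half).
-/
import Summits.HodgeConjecture.HodgeCM.PerL34.WedgeFromLineField
import Summits.HodgeConjecture.HodgeCM.PerL34.CharSpans
import Summits.HodgeConjecture.HodgeCM.PerL34.AssemblyLeaves
import Summits.HodgeConjecture.HodgeCM.Proofs.LevelDirected

/-!
# Seam-vacuity test for S1/S2: the strength of `h33 : WedgeToClasses.StepsPrintInput T`

Referee A (round 15, P1) asked for the junk-instance test of `SeamVacuity` (carver, seam S3: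
`ClusterOutputs T ↔ T.Open_chars` modulo a non-zero vector) on the OTHER data binder of
`AssemblyLeaves.perL_of_leaves'`, namely `h33 : WedgeToClasses.StepsPrintInput T` (seams S1/S2; the root of the
chain `BallStepsInput → BallSpanStepsInput → CharSpanStepsInput → WeilStepsInput → …` of nodes N33/N33a–e).

ANSWER (KERNEL, this file).  Modulo the two KERNEL facts the chain already uses — `LevelDirected`
(`HodgeCM.levelDirected`) and pv01's `N33eClosed` (`n33eClosed_holds`) — the interface is EQUIVALENT to the
following statement about the model's posited data `Theta`, `cup2C` ALONE:

  `Open_thetaWedgeHereditary T` :  in every good context there is a level `Γ₀` such that for EVERY level `Γ ≤ Γ₀`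
  (i) there are `ω₁ ∈ Θ₀(Γ)`, `ω₂ ∈ Θ₁(Γ)` with `ω₁ ∪ ω₂ ≠ 0`, and (ii) `Θ₀(Γ) ∩ Θ₁(Γ) ≠ ∅`.

* `stepsPrintInput_iff : StepsPrintInput T ↔ Open_thetaWedgeHereditary T` (under `LevelDirected`, `N33eClosed`);
  unconditionally `stepsPrintInput_iff'` with the two kernel facts plugged in.
* `open_thetaWedge_of_hereditary : Open_thetaWedgeHereditary T → T.Open_thetaWedge` (take `Γ := Γ₀`).
* every refinement of the chain implies it: `hereditary_of_ballSteps`, `hereditary_of_ballSpans`,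
  `hereditary_of_charSpans (hch : T.Open_chars)`; hence (compose with `CharSpansWeil.charSpanStepsInput_of_weil`,
  `CharSpansCR.weilStepsInput_of_CR`, `CharSpansFinal.weilStepsInputCR_of_CRΔ`, runs 22–23) also
  `WeilStepsInput T`, `WeilStepsInputCR T`, `WeilStepsInputCRΔ T`.

READING (for FACTS.md §0 "LEAF WIRING IS TYPE-LEVEL" and referee A G2/P1).  Exactly as for S3, the RECORD SHAPE of
`h33` carries no content of Prop 4.3's proof: `(⇐)` is witnessed by a JUNK forms dictionary (`junkModel`: the
two-point "ball" `X := ℤˣ` with `G := GL₂(ℂ) × ℤˣ` acting through the sign, cotangent fibre `ℂ²` moved by the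
matrix, `Δ := ⊤`, the EVEN functions as `Θ₀`-spans and the ODD functions as `Θ₁`-spans, every datum allowed, and a
class map reading off the classes provided by `Open_thetaWedgeHereditary`).  So "N33 fed by name through `h33`"
means: the interface type-checks and is (hereditary-)A6-strong, no more.  The mathematics of nodes N33c/N33e/N33b
and of the seats pv03/pv02/pv14/pv01 (transitivity and isotropy of `U(2,1)` on `𝔹²`, the Jacobian cocycle, the
line-field alternative, real approximation, `(X2)`, the `K`-type bridge …) bears on PerL only through the HONEST
instantiation — the canonical ball dictionary `BallCR.ballFD` with `Γ` = the image of `G_U(L₀)` — which the later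
records FIX (`WeilStepsInputCRΔ`, run 23); those records are therefore at least as strong (`hereditary_of_*`) and
their faithfulness is a per-docstring matter, as the honesty notes of `WedgeToClasses` / `CharSpansFinal` say.

On (i) vs A6: `Open_thetaWedge` asks for ONE level; the hereditary form is what the dictionary `Dict_*` (classes at
every level below `lvl u`) produces.  In the intended model the two agree (pull-back along the finite étale covers
`P_Γ → P_Γ₀` is injective on `H¹`, `H²` and compatible with `∪`; theta one-forms pull back to theta one-forms) — a
remark, used nowhere.  On (ii): it records `cls Γ 0 ∈ Θ₀(Γ) ∩ Θ₁(Γ)` (the zero form lies in every span); in the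
intended model `0 = u_0 ∈ Θ_i(Γ)`.  Neither (i) nor (ii) is an input of any assembly theorem.

NOTHING is cited or posited here; no placeholders, no new constants; axioms = the Lean trio.
-/

noncomputable section

namespace HodgeCM
namespace PerL34
namespace StepsVacuity

open HodgeCM.PerL34.WedgeNonvanishing HodgeCM.PerL34.WedgeToClasses
open scoped Matrix

variable {U : Universe}

/-! ## The hereditary form of A6 -/

/-- **Hereditary A6**: in every good context there is a level `Γ₀` such that at EVERY level `Γ ≤ Γ₀` the model has
theta classes `ω₁ ∈ Θ₀(Γ)`, `ω₂ ∈ Θ₁(Γ)` with `ω₁ ∪ ω₂ ≠ 0`, and `Θ₀(Γ) ∩ Θ₁(Γ)` is non-empty. -/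
def Open_thetaWedgeHereditary (T : U.ThetaModel) : Prop :=
  ∀ {L : CMField} {ι₁ : L →+* ℂ} (V : HermSpace3 L ι₁) (c : SeesawCtx L), T.GoodCtx ι₁ c →
    ∃ Γ₀ : Level V, ∀ Γ : Level V, Γ.Γ ≤ Γ₀.Γ →
      (∃ ω₁ ∈ T.Theta V c 0 Γ, ∃ ω₂ ∈ T.Theta V c 1 Γ, U.cup2C (U.pms L ι₁ V Γ) 1 ω₁ ω₂ ≠ 0) ∧
        (T.Theta V c 0 Γ ∩ T.Theta V c 1 Γ).Nonempty

variable (T : U.ThetaModel)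

/-- Hereditary A6 ⇒ A6 (`Open_thetaWedge`, = carver's `N33_wedge T`): take `Γ := Γ₀`. -/
theorem open_thetaWedge_of_hereditary (h : Open_thetaWedgeHereditary T) : T.Open_thetaWedge := by
  intro L ι₁ V c hc
  obtain ⟨Γ₀, hΓ₀⟩ := h V c hc
  obtain ⟨⟨ω₁, hω₁, ω₂, hω₂, hne⟩, -⟩ := hΓ₀ Γ₀ le_rfl
  exact ⟨Γ₀, ω₁, hω₁, ω₂, hω₂, hne⟩

/-! ## `(⇒)`: the interface gives hereditary A6 -/

/-- `StepsPrintInput T` ⇒ hereditary A6, using directedness of levels and pv01's N33e (both KERNEL in the package). -/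
theorem hereditary_of_stepsPrintInput (hLD : LevelDirected) (hE : N33eClosed) (h : StepsPrintInput T) :
    Open_thetaWedgeHereditary T := by
  intro L ι₁ V c hc
  obtain ⟨F, hS, h₀, h₁, hcup⟩ := h V c hc
  obtain ⟨d₁, d₂, ha₁, ha₂, u₁, hu₁, u₂, hu₂, hx⟩ :=
    F.toFormsModel.wedgeOnForms_of_steps (F.steps_of_stepsPrint hE hS)
  obtain ⟨Γ', hΓ'₁, hΓ'₂⟩ := hLD L ι₁ V (F.lvl u₁) (F.lvl u₂)
  obtain ⟨Γ₀, hΓ₀', hΓ₀0⟩ := hLD L ι₁ V Γ' (F.lvl 0)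
  refine ⟨Γ₀, fun Γ hΓ => ⟨⟨F.cls Γ u₁, h₀ d₁ ha₁ u₁ hu₁ Γ (hΓ.trans (hΓ₀'.trans hΓ'₁)), F.cls Γ u₂,
    h₁ d₂ ha₂ u₂ hu₂ Γ (hΓ.trans (hΓ₀'.trans hΓ'₂)),
    hcup d₁ d₂ u₁ hu₁ u₂ hu₂ Γ (hΓ.trans (hΓ₀'.trans hΓ'₁)) (hΓ.trans (hΓ₀'.trans hΓ'₂)) hx⟩,
    ⟨F.cls Γ 0, h₀ d₁ ha₁ 0 (zero_mem _) Γ (hΓ.trans hΓ₀0), h₁ d₂ ha₂ 0 (zero_mem _) Γ (hΓ.trans hΓ₀0)⟩⟩⟩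

/-! ## `(⇐)`: a junk forms dictionary

The shell: `G := GL₂(ℂ) × ℤˣ` acting on the two-point space `X := ℤˣ` through the second factor, `W := ℂ²` moved
by the first factor (`A (g, s) x := (w ↦ g w)`), `Δ := ⊤`, base point `1`, frame `id`.  The spans: EVEN functions
`X → ℂ²` for type `Ψ₁`, ODD functions for type `Ψ₂` — both non-zero, `⊤`-stable, made of continuous functions, and
meeting only in `0`. -/

/-- the shell group `GL₂(ℂ) × {±1}` -/
abbrev JG : Type := (Matrix (Fin 2) (Fin 2) ℂ)ˣ × ℤˣ

/- The action of `JG` on `{±1}` through the sign and its continuity are LOCAL instances (hygiene: nothing outside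
this file sees them; `junkModel` stores them as its structure fields). -/
/-- (Ported verbatim from the HodgeCMPerL package; no docstring in the source.) -/
local instance instSMulJG : SMul JG ℤˣ := ⟨fun p x => p.2 * x⟩

/-- (Ported verbatim from the HodgeCMPerL package; no docstring in the source.) -/
theorem smul_def (p : JG) (x : ℤˣ) : p • x = p.2 * x := rfl

/-- (Ported verbatim from the HodgeCMPerL package; no docstring in the source.) -/
local instance instMulActionJG : MulAction JG ℤˣ where
  one_smul x := by simp [smul_def]
  mul_smul p q x := by simp [smul_def, mul_assoc]

/-- (Ported verbatim from the HodgeCMPerL package; no docstring in the source.) -/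
local instance instContinuousSMulJG : ContinuousSMul JG ℤˣ := by
  refine ⟨?_⟩
  have h1 : Continuous fun p : JG × ℤˣ => (p.1.2, p.2) :=
    (continuous_snd.comp continuous_fst).prodMk continuous_snd
  have h2 : Continuous fun q : ℤˣ × ℤˣ => q.1 * q.2 := continuous_of_discreteTopology
  exact h2.comp h1

/-- the even `ℂ²`-valued functions on `{±1}` -/
def evenF : Submodule ℂ (ℤˣ → Fin 2 → ℂ) where
  carrier := {u | u (-1) = u 1}
  add_mem' {u v} hu hv := by
    simp only [Set.mem_setOf_eq, Pi.add_apply] at hu hv ⊢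
    rw [hu, hv]
  zero_mem' := by simp
  smul_mem' a u hu := by
    simp only [Set.mem_setOf_eq, Pi.smul_apply] at hu ⊢
    rw [hu]

/-- the odd `ℂ²`-valued functions on `{±1}` -/
def oddF : Submodule ℂ (ℤˣ → Fin 2 → ℂ) where
  carrier := {u | u (-1) = -u 1}
  add_mem' {u v} hu hv := by
    simp only [Set.mem_setOf_eq, Pi.add_apply] at hu hv ⊢
    rw [hu, hv, neg_add]
  zero_mem' := by simp
  smul_mem' a u hu := by
    simp only [Set.mem_setOf_eq, Pi.smul_apply] at hu ⊢
    rw [hu, smul_neg]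

/-- (Ported verbatim from the HodgeCMPerL package; no docstring in the source.) -/
theorem mem_evenF {u : ℤˣ → Fin 2 → ℂ} : u ∈ evenF ↔ u (-1) = u 1 := Iff.rfl

/-- (Ported verbatim from the HodgeCMPerL package; no docstring in the source.) -/
theorem mem_oddF {u : ℤˣ → Fin 2 → ℂ} : u ∈ oddF ↔ u (-1) = -u 1 := Iff.rfl

/-- even ∩ odd = 0 -/
theorem eq_zero_of_mem_evenF_of_mem_oddF {u : ℤˣ → Fin 2 → ℂ} (he : u ∈ evenF) (ho : u ∈ oddF) : u = 0 := by
  rw [mem_evenF] at he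
  rw [mem_oddF] at ho
  have h1 : u 1 = 0 := by
    have h2 : (2 : ℂ) • u 1 = 0 := by
      rw [two_smul]
      nth_rewrite 1 [← he]
      rw [ho, neg_add_cancel]
    exact (smul_eq_zero.1 h2).resolve_left two_ne_zero
  funext x
  rcases Int.units_eq_one_or x with rfl | rfl
  · simp [h1]
  · rw [he]; simp [h1]

/-- a non-zero even function: the constant `(1, 1)` -/
theorem evenF_ne_bot : evenF ≠ ⊥ := by
  rw [Submodule.ne_bot_iff]
  refine ⟨fun _ _ => 1, by simp [mem_evenF], fun h => ?_⟩
  have := congr_fun (congr_fun h 1) 0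
  simp at this

/-- a non-zero odd function: the sign -/
theorem oddF_ne_bot : oddF ≠ ⊥ := by
  rw [Submodule.ne_bot_iff]
  refine ⟨fun s _ => ((s : ℤ) : ℂ), ?_, fun h => ?_⟩
  · rw [mem_oddF]; funext i; simp
  · have := congr_fun (congr_fun h 1) 0
    simp at this

/-- the cocycle: the matrix factor acting on `ℂ²` -/
def JA (p : JG) : (Fin 2 → ℂ) →L[ℂ] (Fin 2 → ℂ) :=
  LinearMap.toContinuousLinearMap (Matrix.mulVecLin (p.1 : Matrix (Fin 2) (Fin 2) ℂ))

/-- (Ported verbatim from the HodgeCMPerL package; no docstring in the source.) -/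
@[simp] theorem JA_apply (p : JG) (w : Fin 2 → ℂ) : JA p w = (p.1 : Matrix (Fin 2) (Fin 2) ℂ) *ᵥ w := by
  simp [JA]

/-- `⊤`-stability of the even functions under `u ↦ (x ↦ g · u(s x))`. -/
theorem stable_evenF : StableUnder (⊤ : Subgroup JG) (fun p _ => JA p) evenF := by
  intro p _ u hu
  refine ⟨fun y => (p.1 : Matrix (Fin 2) (Fin 2) ℂ) *ᵥ u (p.2 * y), ?_, fun x => ?_⟩
  · rw [mem_evenF] at hu ⊢
    rcases Int.units_eq_one_or p.2 with h | h
    · simp [h, hu]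
    · simp [h, hu]
  · simp [smul_def, ← mul_assoc, Int.units_mul_self]

/-- `⊤`-stability of the odd functions. -/
theorem stable_oddF : StableUnder (⊤ : Subgroup JG) (fun p _ => JA p) oddF := by
  intro p _ u hu
  refine ⟨fun y => (p.1 : Matrix (Fin 2) (Fin 2) ℂ) *ᵥ u (p.2 * y), ?_, fun x => ?_⟩
  · rw [mem_oddF] at hu ⊢
    rcases Int.units_eq_one_or p.2 with h | h
    · simp [h, hu, Matrix.mulVec_neg]
    · simp [h, hu, Matrix.mulVec_neg]
  · simp [smul_def, ← mul_assoc, Int.units_mul_self]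

variable {L : CMField} {ι₁ : L →+* ℂ}

open Classical in
/-- **The junk forms dictionary** of a context, built from a level `Γ₀` and three level-indexed families of classes
(`ω₁`, `ω₂`: the classes with non-zero cup product; `z`: a class in `Θ₀ ∩ Θ₁`, the image of the zero form). -/
def junkModel (V : HermSpace3 L ι₁) (Γ₀ : Level V)
    (ω₁ ω₂ z : ∀ Γ : Level V, Γ.Γ ≤ Γ₀.Γ → U.CohC (U.pms L ι₁ V Γ) 1) : FormsModelT U V where
  G := JG
  X := ℤˣ
  W := Fin 2 → ℂ
  Δ := ⊤
  A := fun p _ => JA p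
  D₁ := Unit
  D₂ := Unit
  gen₁ := fun _ => evenF
  gen₂ := fun _ => oddF
  allowed₁ := fun _ => True
  allowed₂ := fun _ => True
  lvl := fun _ => Γ₀
  cls := fun Γ u =>
    if h : Γ.Γ ≤ Γ₀.Γ then (if u = 0 then z Γ h else if u ∈ evenF then ω₁ Γ h else ω₂ Γ h) else 0
  x₀ := 1
  e := LinearEquiv.refl ℂ (Fin 2 → ℂ)

/-- The junk dictionary satisfies N33c, the four PRINT shell facts and L4.2(b). -/
theorem junkModel_stepsPrint (V : HermSpace3 L ι₁) (Γ₀ : Level V)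
    (ω₁ ω₂ z : ∀ Γ : Level V, Γ.Γ ≤ Γ₀.Γ → U.CohC (U.pms L ι₁ V Γ) 1) :
    (junkModel (U := U) V Γ₀ ω₁ ω₂ z).StepsPrint := by
  refine ⟨⟨⟨?_, ?_, ?_⟩, ⟨?_, ?_, ?_⟩⟩, ?_, ?_, ⟨?_, ?_⟩, ?_, fun _ => trivial, fun _ => trivial⟩
  · show (⨆ _ : Unit, evenF) ≠ ⊥
    rw [iSup_const]; exact evenF_ne_bot
  · intro u _; exact continuous_of_discreteTopology (α := ℤˣ)
  · show StableUnder (⊤ : Subgroup JG) (fun p _ => JA p) (⨆ _ : Unit, evenF)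
    rw [iSup_const]; exact stable_evenF
  · show (⨆ _ : Unit, oddF) ≠ ⊥
    rw [iSup_const]; exact oddF_ne_bot
  · intro u _; exact continuous_of_discreteTopology (α := ℤˣ)
  · show StableUnder (⊤ : Subgroup JG) (fun p _ => JA p) (⨆ _ : Unit, oddF)
    rw [iSup_const]; exact stable_oddF
  · show Dense ((⊤ : Subgroup JG) : Set JG)
    rw [Subgroup.coe_top]; exact dense_univ
  · show ∀ x : ℤˣ, Function.Surjective fun p : JG => p • x
    intro x y
    exact ⟨((1 : (Matrix (Fin 2) (Fin 2) ℂ)ˣ), y * x⁻¹), by simp [smul_def, mul_assoc, Int.units_mul_self]⟩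
  · show ∀ (p : JG) (_x : ℤˣ), Function.Injective (JA p)
    intro p _ v w hvw
    have h := Matrix.mulVec_injective_iff_isUnit.2 (Units.isUnit p.1)
    simp only [JA_apply] at hvw
    exact h hvw
  · intro w
    show Continuous fun p : JG => JA p w
    simp only [JA_apply]
    exact (Units.continuous_val.comp continuous_fst).matrix_mulVec continuous_const
  · show ∀ g ∈ Matrix.specialUnitaryGroup (Fin 2) ℂ, ∃ k : JG, k • (1 : ℤˣ) = 1 ∧ ∃ c : ℂ, c ≠ 0 ∧
      ∀ w : Fin 2 → ℂ, (LinearEquiv.refl ℂ (Fin 2 → ℂ)) (JA k w) = c • (g *ᵥ (LinearEquiv.refl ℂ (Fin 2 → ℂ)) w)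
    intro g hg
    refine ⟨(Unitary.toUnits ⟨g, (Matrix.mem_specialUnitaryGroup_iff.1 hg).1⟩, 1), by simp [smul_def], 1,
      one_ne_zero, fun w => ?_⟩
    simp [JA_apply]

open Classical in
/-- the class map of the junk dictionary below level `Γ₀` -/
theorem junkModel_cls (V : HermSpace3 L ι₁) (Γ₀ : Level V)
    (ω₁ ω₂ z : ∀ Γ : Level V, Γ.Γ ≤ Γ₀.Γ → U.CohC (U.pms L ι₁ V Γ) 1) (Γ : Level V) (hΓ : Γ.Γ ≤ Γ₀.Γ)
    (u : ℤˣ → Fin 2 → ℂ) :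
    (junkModel (U := U) V Γ₀ ω₁ ω₂ z).cls Γ u =
      if u = 0 then z Γ hΓ else if u ∈ evenF then ω₁ Γ hΓ else ω₂ Γ hΓ := by
  simp only [junkModel, dif_pos hΓ]

/-- (Ported verbatim from the HodgeCMPerL package; no docstring in the source.) -/
theorem junkModel_cls_zero (V : HermSpace3 L ι₁) (Γ₀ : Level V)
    (ω₁ ω₂ z : ∀ Γ : Level V, Γ.Γ ≤ Γ₀.Γ → U.CohC (U.pms L ι₁ V Γ) 1) (Γ : Level V) (hΓ : Γ.Γ ≤ Γ₀.Γ) :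
    (junkModel (U := U) V Γ₀ ω₁ ω₂ z).cls Γ (0 : ℤˣ → Fin 2 → ℂ) = z Γ hΓ := by
  rw [junkModel_cls V Γ₀ ω₁ ω₂ z Γ hΓ]
  exact if_pos rfl

/-- (Ported verbatim from the HodgeCMPerL package; no docstring in the source.) -/
theorem junkModel_cls_even (V : HermSpace3 L ι₁) (Γ₀ : Level V)
    (ω₁ ω₂ z : ∀ Γ : Level V, Γ.Γ ≤ Γ₀.Γ → U.CohC (U.pms L ι₁ V Γ) 1) (Γ : Level V) (hΓ : Γ.Γ ≤ Γ₀.Γ)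
    {u : ℤˣ → Fin 2 → ℂ} (hu : u ∈ evenF) (h0 : u ≠ 0) :
    (junkModel (U := U) V Γ₀ ω₁ ω₂ z).cls Γ u = ω₁ Γ hΓ := by
  rw [junkModel_cls V Γ₀ ω₁ ω₂ z Γ hΓ, if_neg h0, if_pos hu]

/-- (Ported verbatim from the HodgeCMPerL package; no docstring in the source.) -/
theorem junkModel_cls_odd (V : HermSpace3 L ι₁) (Γ₀ : Level V)
    (ω₁ ω₂ z : ∀ Γ : Level V, Γ.Γ ≤ Γ₀.Γ → U.CohC (U.pms L ι₁ V Γ) 1) (Γ : Level V) (hΓ : Γ.Γ ≤ Γ₀.Γ)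
    {u : ℤˣ → Fin 2 → ℂ} (hu : u ∈ oddF) (h0 : u ≠ 0) :
    (junkModel (U := U) V Γ₀ ω₁ ω₂ z).cls Γ u = ω₂ Γ hΓ := by
  have hne : u ∉ evenF := fun he => h0 (eq_zero_of_mem_evenF_of_mem_oddF he hu)
  rw [junkModel_cls V Γ₀ ω₁ ω₂ z Γ hΓ, if_neg h0, if_neg hne]

/-- **`(⇐)`**: hereditary A6 ⇒ `StepsPrintInput T`, by the junk dictionary. -/
theorem stepsPrintInput_of_hereditary (h : Open_thetaWedgeHereditary T) : StepsPrintInput T := by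
  intro L ι₁ V c hc
  obtain ⟨Γ₀, hΓ₀⟩ := h V c hc
  choose ω₁ hω₁ ω₂ hω₂ hcup using fun (Γ : Level V) (hΓ : Γ.Γ ≤ Γ₀.Γ) => (hΓ₀ Γ hΓ).1
  choose z hz using fun (Γ : Level V) (hΓ : Γ.Γ ≤ Γ₀.Γ) => (hΓ₀ Γ hΓ).2
  refine ⟨junkModel V Γ₀ ω₁ ω₂ z, junkModel_stepsPrint V Γ₀ ω₁ ω₂ z, ?_, ?_, ?_⟩
  · intro d _ u hu Γ hΓ
    change u ∈ evenF at hu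
    change Γ.Γ ≤ Γ₀.Γ at hΓ
    by_cases hu0 : (u : ℤˣ → Fin 2 → ℂ) = 0
    · rw [hu0]
      show (junkModel V Γ₀ ω₁ ω₂ z).cls Γ (0 : ℤˣ → Fin 2 → ℂ) ∈ T.Theta V c 0 Γ
      rw [junkModel_cls_zero V Γ₀ ω₁ ω₂ z Γ hΓ]; exact (hz Γ hΓ).1
    · rw [junkModel_cls_even V Γ₀ ω₁ ω₂ z Γ hΓ hu hu0]; exact hω₁ Γ hΓ
  · intro d _ u hu Γ hΓ
    change u ∈ oddF at hu
    change Γ.Γ ≤ Γ₀.Γ at hΓ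
    by_cases hu0 : (u : ℤˣ → Fin 2 → ℂ) = 0
    · rw [hu0]
      show (junkModel V Γ₀ ω₁ ω₂ z).cls Γ (0 : ℤˣ → Fin 2 → ℂ) ∈ T.Theta V c 1 Γ
      rw [junkModel_cls_zero V Γ₀ ω₁ ω₂ z Γ hΓ]; exact (hz Γ hΓ).2
    · rw [junkModel_cls_odd V Γ₀ ω₁ ω₂ z Γ hΓ hu hu0]; exact hω₂ Γ hΓ
  · intro d₁ d₂ u₁ hu₁ u₂ hu₂ Γ hΓ₁ hΓ₂ hx
    obtain ⟨x, hx⟩ := hx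
    change u₁ ∈ evenF at hu₁
    change u₂ ∈ oddF at hu₂
    change Γ.Γ ≤ Γ₀.Γ at hΓ₁
    have e₁ := hx.ne_zero 0
    have e₂ := hx.ne_zero 1
    simp only [Matrix.cons_val_zero, Matrix.cons_val_one] at e₁ e₂
    have h1 : (u₁ : ℤˣ → Fin 2 → ℂ) ≠ 0 := fun h0 => e₁ (by rw [h0]; rfl)
    have h2 : (u₂ : ℤˣ → Fin 2 → ℂ) ≠ 0 := fun h0 => e₂ (by rw [h0]; rfl)
    rw [junkModel_cls_even V Γ₀ ω₁ ω₂ z Γ hΓ₁ hu₁ h1, junkModel_cls_odd V Γ₀ ω₁ ω₂ z Γ hΓ₁ hu₂ h2]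
    exact hcup Γ hΓ₁

/-! ## The equivalence and its corollaries -/

/-- **Seam-vacuity for S1/S2**: modulo `LevelDirected` and `N33eClosed`, `StepsPrintInput T` is EQUIVALENT to
hereditary A6. -/
theorem stepsPrintInput_iff (hLD : LevelDirected) (hE : N33eClosed) :
    StepsPrintInput T ↔ Open_thetaWedgeHereditary T :=
  ⟨hereditary_of_stepsPrintInput T hLD hE, stepsPrintInput_of_hereditary T⟩

/-- The same with the package's KERNEL proofs of the two facts plugged in (unconditional). -/
theorem stepsPrintInput_iff' : StepsPrintInput T ↔ Open_thetaWedgeHereditary T :=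
  stepsPrintInput_iff T HodgeCM.levelDirected n33eClosed_holds

/-- `StepsInput T` (the forms-level record with N33e as a field) also implies hereditary A6. -/
theorem hereditary_of_stepsInput (hLD : LevelDirected) (h : StepsInput T) : Open_thetaWedgeHereditary T := by
  intro L ι₁ V c hc
  obtain ⟨F, hS, h₀, h₁, hcup⟩ := h V c hc
  obtain ⟨d₁, d₂, ha₁, ha₂, u₁, hu₁, u₂, hu₂, hx⟩ := F.wedgeOnForms_of_steps hS
  obtain ⟨Γ', hΓ'₁, hΓ'₂⟩ := hLD L ι₁ V (F.lvl u₁) (F.lvl u₂)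
  obtain ⟨Γ₀, hΓ₀', hΓ₀0⟩ := hLD L ι₁ V Γ' (F.lvl 0)
  refine ⟨Γ₀, fun Γ hΓ => ⟨⟨F.cls Γ u₁, h₀ d₁ ha₁ u₁ hu₁ Γ (hΓ.trans (hΓ₀'.trans hΓ'₁)), F.cls Γ u₂,
    h₁ d₂ ha₂ u₂ hu₂ Γ (hΓ.trans (hΓ₀'.trans hΓ'₂)),
    hcup d₁ d₂ u₁ hu₁ u₂ hu₂ Γ (hΓ.trans (hΓ₀'.trans hΓ'₁)) (hΓ.trans (hΓ₀'.trans hΓ'₂)) hx⟩,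
    ⟨F.cls Γ 0, h₀ d₁ ha₁ 0 (zero_mem _) Γ (hΓ.trans hΓ₀0), h₁ d₂ ha₂ 0 (zero_mem _) Γ (hΓ.trans hΓ₀0)⟩⟩⟩

/-- pv02's forms record `FormsInput` (run 19) ⇒ hereditary A6 (same proof, from the `WedgeOnForms` conjunct). -/
theorem hereditary_of_formsInput (hLD : LevelDirected) (h : FormsInput T) : Open_thetaWedgeHereditary T := by
  intro L ι₁ V c hc
  obtain ⟨F, hW, h₀, h₁, hcup⟩ := h V c hc
  obtain ⟨d₁, d₂, ha₁, ha₂, u₁, hu₁, u₂, hu₂, hx⟩ := hW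
  obtain ⟨Γ', hΓ'₁, hΓ'₂⟩ := hLD L ι₁ V (F.lvl u₁) (F.lvl u₂)
  obtain ⟨Γ₀, hΓ₀', hΓ₀0⟩ := hLD L ι₁ V Γ' (F.lvl 0)
  refine ⟨Γ₀, fun Γ hΓ => ⟨⟨F.cls Γ u₁, h₀ d₁ ha₁ u₁ hu₁ Γ (hΓ.trans (hΓ₀'.trans hΓ'₁)), F.cls Γ u₂,
    h₁ d₂ ha₂ u₂ hu₂ Γ (hΓ.trans (hΓ₀'.trans hΓ'₂)),
    hcup d₁ d₂ u₁ hu₁ u₂ hu₂ Γ (hΓ.trans (hΓ₀'.trans hΓ'₁)) (hΓ.trans (hΓ₀'.trans hΓ'₂)) hx⟩,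
    ⟨F.cls Γ 0, h₀ d₁ ha₁ 0 (zero_mem _) Γ (hΓ.trans hΓ₀0), h₁ d₂ ha₂ 0 (zero_mem _) Γ (hΓ.trans hΓ₀0)⟩⟩⟩

/-- **All three S1/S2 records of the tree are equivalent to hereditary A6** (remark of pv08-g3, 05:39:13Z):
`FormsInput T ↔ StepsInput T ↔ StepsPrintInput T ↔ Open_thetaWedgeHereditary T`. -/
theorem stepsInput_iff' : StepsInput T ↔ Open_thetaWedgeHereditary T :=
  ⟨hereditary_of_stepsInput T HodgeCM.levelDirected, fun h =>
    stepsInput_of_stepsPrintInput (T := T) n33eClosed_holds (stepsPrintInput_of_hereditary T h)⟩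


-- port_pkg: scope closed for this part
end StepsVacuity
end PerL34
end HodgeCM
end
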